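import Literature.IUT.HodgeTheaters.Cor53iFcircHkerOfMonoidRigidity
import Literature.IUT.HodgeTheaters.Cor53TelescopeCensusKnit
import Literature.IUT.HodgeTheaters.GlobalFrobenioidsFcircRecordBaseOnEquivalences
import Literature.AlgebraicGeometry.Frobenioids.ModelFrobenioidFiberProductPullback
import HarnessLib

/-!
# [IUTchI] Cor 5.3 (i) «respectively `⊚`» AT THE RECORD CARRIER: `hker⊚` for `†ℱ^⊚ → †𝒟^⊚` of ANY isomorph `†ℱ^⊛` of the
# arithmetic model over `ℬ(H)⁰`, `H` slim, from the Ex 5.1 (v) unit-ratio law at the restricted data ALONE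

S. Mochizuki, *Inter-universal Teichmüller theory I*, kurims manuscript (May 2020), §5 Cor 5.3 (i) p. 144 l. 2–11 («resp. `⊚`») and
its proof l. 24–33; Ex 5.1 (iii) pp. 125–126 («`†ℱ^⊚ := †ℱ^⊛|_{†𝒟^⊚}`»), (v)/(vi) pp. 127–130 ([IUTchI] Cor 5.3 (i) p.144)
[claim: Mochizuki2012, status: disputed] (nothing of the series is asserted; no side taken on [IUTchIII] Cor. 3.12); [FrdI] §0 p. 17
(categorical fibre products), Prop 1.6 p. 27, Thm 5.2 (i) p. 100, Cor 4.11 pp. 91–92 [cite: MochizukiFrdI2008, Prop. 1.6 p.27].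

PROOF-ONLY (cell abc-iut, seat abc-iut-L5-t11 gen 16, row «C53I-FCIRC-HKER» file F3, abc-iut-L5-lead RULINGS #154 (2b)).  TARGET: the
(k2) binder `hker⊚` of abc-iut-L5-t4's ★ `Cor53TelescopeCensusKnit` VERBATIM — `CatIsomorphism.RigidOverBase 𝓕.fcircBase` for
`𝓕 : GlobalFrobenioid (GlobalDivisorData.arith F) (BaseCat H) toBase0`, `H` slim, ANY `toBase0`.  ROUTE (all bricks BY NAME):
abc-iut-w4-d050/d109's `GlobalFrobenioid.exists_fcirc_equivalence_fiberProduct_over` (`†ℱ^⊚ ≌ ℱ^⊛(†𝒟^⊚) ×_{ℬ(G_F)⁰} ℬ(H)⁰` along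
`T := baseMor ⋙ identify`, over `ℬ(H)⁰` ON THE NOSE), abc-iut-w4-d109's L1 brick `ModelFrobenioid.exists_fiberProduct_equivalence`
(that fibre product `≌` the model Frobenioid of the RESTRICTED data `(Φ^⊛ ∘ T, 𝔹^⊛ ∘ T, Div ∘ T)`, over `ℬ(H)⁰` ON THE NOSE; [FrdI]
Prop 1.6), §0 `CatIsomorphism.rigidOverBase_of_equivalence_over` (`RigidOverBase` transports along an equivalence of total
categories lying over the base), and this seat's file F2 ★ `Cor53iFcircHkerOfMonoidRigidity` (`hker` at that model from 𝔹-RATIO⊚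
alone — [FrdI] Cor 4.11 (ii)/(iii)/(iv), group-like `𝔹`, Φ-RIGID-PRINC all PROVED there / in file F1 / by abc-iut-L5-t1 R82).
RESULT **`Cor53.fcirc_rigidOverBase_of_ratioRigid 𝓕 hZ hB : RigidOverBase 𝓕.fcircBase`** and, through (k2), the injective /
«bijective» forms `Cor53.fcirc_descend_injective_of_ratioRigid`, `Cor53.fcirc_descendBijective_of_ratioRigid_of_lifts`.
CENSUS of the `⊚`-slot of IUTchI:Cor5.3(i) after this file: `hker⊚ ⟸` LAW 0 · [FrdI] §0/Prop 1.6/Cor 4.11 PROVED · Φ-RIGID-PRINC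
PROVED · FACT-SHAPE 1 {𝔹-RATIO⊚ = Ex 5.1 (v) at the restricted data `Δ|_T` ≙ F-2577} · side {IsSlimGroup H}; `hlift⊚` (surjectivity
half) remains abc-iut-w4-d109's `Cor53iFcircLiftsAll` lane.  HONEST TAGS: 𝔹-RATIO⊚ and `hlift⊚` displayed, not proved; no token moves
on this file alone; typed ≠ proved; nothing here asserts abc proved or refuted.
-/

noncomputable section

-- `ModelFrobenioid.baseFunctor` / `PreFrobenioid.baseFunctor (toElem …)` / `(arith F).Φ = (galoisSubextOfFinite F).op ⋙ Φ` agree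
-- only at default transparency.
set_option backward.isDefEq.respectTransparency false

namespace Literature.IUT.HodgeTheaters

open CategoryTheory Opposite NumberField
open Literature.AlgebraicGeometry.Frobenioids Literature.AnabelianGeometry.SemiGraphs
open Literature.AlgebraicGeometry.Frobenioids.QuasiTemperoid
open Literature.AlgebraicGeometry.Frobenioids.PreFrobenioid

/-! ### §0. `RigidOverBase` transports along an equivalence of total categories lying over the base -/

namespace CatIsomorphism

universe v₁ v₂ v₃ u₁ u₂ u₃

variable {C : Type u₁} [Category.{v₁} C] {C' : Type u₂} [Category.{v₂} C'] {B : Type u₃} [Category.{v₃} B]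

/-- **`RigidOverBase` is invariant under equivalences OVER the base**: if `e : C′ ⥲ C` lies over `B` (`e ⋙ p ≅ p′`) and every
self-equivalence of `C` over the identity of `B` is `≅ 𝟭`, then so is every self-equivalence `Ψ′` of `C′` over the identity —
conjugate `Ψ′` by `e`, read the conclusion back through the unit of `e` ([FrdI] §0: structure functors are considered up to
equivalence over the base). ([IUTchI] Cor 5.3 (i) p.144) [cite: MochizukiFrdI2008, §0 p.17] [claim: Mochizuki2012, status: disputed] -/
theorem rigidOverBase_of_equivalence_over {p : C ⥤ B} {p' : C' ⥤ B} (e : C' ≌ C) (i : e.functor ⋙ p ≅ p')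
    (hp : RigidOverBase p) : RigidOverBase p' := by
  rintro Ψ' ⟨j⟩
  -- `Ψ′ ⋙ p′ ≅ p′` and `e⁻¹ ⋙ p′ ≅ p`
  have j' : Ψ'.functor ⋙ p' ≅ p' := j ≪≫ p'.rightUnitor
  have i' : e.inverse ⋙ p' ≅ p :=
    Functor.isoWhiskerLeft e.inverse i.symm ≪≫ (Functor.associator _ _ _).symm ≪≫
      Functor.isoWhiskerRight e.counitIso p ≪≫ p.leftUnitor
  -- the conjugate `e⁻¹ ⋙ Ψ′ ⋙ e` lies over the identity of `B`
  have k : (e.symm.trans (Ψ'.trans e)).functor ⋙ p ≅ p ⋙ (CategoryTheory.Equivalence.refl (C := B)).functor :=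
    Functor.associator e.inverse (Ψ'.functor ⋙ e.functor) p ≪≫
      Functor.isoWhiskerLeft e.inverse (Functor.associator Ψ'.functor e.functor p ≪≫
        Functor.isoWhiskerLeft Ψ'.functor i ≪≫ j') ≪≫ i' ≪≫ p.rightUnitor.symm
  obtain ⟨m⟩ := hp (e.symm.trans (Ψ'.trans e)) ⟨k⟩
  -- `m : e⁻¹ ⋙ Ψ′ ⋙ e ≅ 𝟭 C`; whisker with `e`, `e⁻¹` and close with the unit
  have m' : e.functor ⋙ (e.inverse ⋙ (Ψ'.functor ⋙ e.functor)) ⋙ e.inverse ≅ e.functor ⋙ e.inverse :=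
    Functor.isoWhiskerLeft e.functor (Functor.isoWhiskerRight m e.inverse ≪≫ e.inverse.leftUnitor)
  exact ⟨Ψ'.functor.leftUnitor.symm ≪≫ Functor.isoWhiskerRight e.unitIso Ψ'.functor ≪≫
    (Functor.associator _ _ _) ≪≫ Functor.isoWhiskerLeft e.functor
      ((e.inverse ⋙ Ψ'.functor).rightUnitor.symm ≪≫ Functor.isoWhiskerLeft (e.inverse ⋙ Ψ'.functor) e.unitIso ≪≫
        (Functor.associator _ _ _).symm) ≪≫
    m' ≪≫ e.unitIso.symm⟩

end CatIsomorphism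

/-! ### §1. `hker⊚` at the record carrier `𝓕.fcircBase : †ℱ^⊚ → ℬ(H)⁰` from 𝔹-RATIO⊚ at the restricted data -/

namespace Cor53

section Fcirc

variable {F : Type} [Field F] [NumberField F] {H : ProfiniteGrp.{0}} {toBase0 : BaseCat H ⥤ BaseCat (absGalGrp F)}
  (𝓕 : GlobalFrobenioid (GlobalDivisorData.arith F) (BaseCat H) toBase0)

/-- **[IUTchI] Cor 5.3 (i) «resp. `⊚`», injectivity content AT THE RECORD CARRIER — `RigidOverBase 𝓕.fcircBase` (the (k2) binder
`hker⊚` of ★ `Cor53TelescopeCensusKnit`, verbatim) for ANY isomorph `†ℱ^⊛` of `ℱ^⊛(†𝒟^⊚)` over `†𝒟^⊚ = ℬ(H)⁰`, `H` slim, from ONE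
displayed binder `hB` = 𝔹-RATIO⊚**: print's Ex 5.1 (v) unit-ratio law for the model Frobenioid of the RESTRICTED arithmetic data
`(Φ^⊛ ∘ T, 𝔹^⊛ ∘ T, Div ∘ T)`, `T := baseMor ⋙ identify : ℬ(H)⁰ → ℬ(G_F)⁰` (FACT-SHAPE ≙ F-2577).  PROOF: `†ℱ^⊚ ≌` that model over
`ℬ(H)⁰` ([FrdI] §0 + Prop 1.6, abc-iut-w4-d050/d109 bricks), §0 transport, file F2 at `S := T ⋙ galoisSubextOfFinite F`.
([IUTchI] Cor 5.3 (i) p.144) [cite: MochizukiFrdI2008, Prop. 1.6 p.27] [claim: Mochizuki2012, status: disputed] -/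
theorem fcirc_rigidOverBase_of_ratioRigid (hZ : IsSlimGroup H)
    (hB : ∀ Ψ : (GlobalDivisorData.mk ((𝓕.baseMor ⋙ 𝓕.identify.functor).op ⋙ (GlobalDivisorData.arith F).Φ)
        ((𝓕.baseMor ⋙ 𝓕.identify.functor).op ⋙ (GlobalDivisorData.arith F).B)
        (Functor.whiskerLeft (𝓕.baseMor ⋙ 𝓕.identify.functor).op (GlobalDivisorData.arith F).div) : GlobalDivisorData H).ModelGlobalFrobenioid ≌
        (GlobalDivisorData.mk ((𝓕.baseMor ⋙ 𝓕.identify.functor).op ⋙ (GlobalDivisorData.arith F).Φ)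
        ((𝓕.baseMor ⋙ 𝓕.identify.functor).op ⋙ (GlobalDivisorData.arith F).B)
        (Functor.whiskerLeft (𝓕.baseMor ⋙ 𝓕.identify.functor).op (GlobalDivisorData.arith F).div) : GlobalDivisorData H).ModelGlobalFrobenioid,
      Nonempty (Ψ.functor ⋙ (GlobalDivisorData.mk ((𝓕.baseMor ⋙ 𝓕.identify.functor).op ⋙ (GlobalDivisorData.arith F).Φ)
        ((𝓕.baseMor ⋙ 𝓕.identify.functor).op ⋙ (GlobalDivisorData.arith F).B)
        (Functor.whiskerLeft (𝓕.baseMor ⋙ 𝓕.identify.functor).op (GlobalDivisorData.arith F).div) : GlobalDivisorData H).modelBase ≅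
        (GlobalDivisorData.mk ((𝓕.baseMor ⋙ 𝓕.identify.functor).op ⋙ (GlobalDivisorData.arith F).Φ)
        ((𝓕.baseMor ⋙ 𝓕.identify.functor).op ⋙ (GlobalDivisorData.arith F).B)
        (Functor.whiskerLeft (𝓕.baseMor ⋙ 𝓕.identify.functor).op (GlobalDivisorData.arith F).div) : GlobalDivisorData H).modelBase) →
      ∃ η : Ψ.functor ⋙ (GlobalDivisorData.mk ((𝓕.baseMor ⋙ 𝓕.identify.functor).op ⋙ (GlobalDivisorData.arith F).Φ)
        ((𝓕.baseMor ⋙ 𝓕.identify.functor).op ⋙ (GlobalDivisorData.arith F).B)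
        (Functor.whiskerLeft (𝓕.baseMor ⋙ 𝓕.identify.functor).op (GlobalDivisorData.arith F).div) : GlobalDivisorData H).modelBase ≅
        (GlobalDivisorData.mk ((𝓕.baseMor ⋙ 𝓕.identify.functor).op ⋙ (GlobalDivisorData.arith F).Φ)
        ((𝓕.baseMor ⋙ 𝓕.identify.functor).op ⋙ (GlobalDivisorData.arith F).B)
        (Functor.whiskerLeft (𝓕.baseMor ⋙ 𝓕.identify.functor).op (GlobalDivisorData.arith F).div) : GlobalDivisorData H).modelBase,
        ∀ ⦃X Y : (GlobalDivisorData.mk ((𝓕.baseMor ⋙ 𝓕.identify.functor).op ⋙ (GlobalDivisorData.arith F).Φ)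
        ((𝓕.baseMor ⋙ 𝓕.identify.functor).op ⋙ (GlobalDivisorData.arith F).B)
        (Functor.whiskerLeft (𝓕.baseMor ⋙ 𝓕.identify.functor).op (GlobalDivisorData.arith F).div) : GlobalDivisorData H).ModelGlobalFrobenioid⦄ (f g : X ⟶ Y),
          ModelFrobenioid.degFr f = 1 → ModelFrobenioid.degFr g = 1 → ModelFrobenioid.baseMap f = ModelFrobenioid.baseMap g →
            ModelFrobenioid.unit (Ψ.functor.map f) *
                pull (GlobalDivisorData.mk ((𝓕.baseMor ⋙ 𝓕.identify.functor).op ⋙ (GlobalDivisorData.arith F).Φ)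
        ((𝓕.baseMor ⋙ 𝓕.identify.functor).op ⋙ (GlobalDivisorData.arith F).B)
        (Functor.whiskerLeft (𝓕.baseMor ⋙ 𝓕.identify.functor).op (GlobalDivisorData.arith F).div) : GlobalDivisorData H).B (A := X.base) (B := (Ψ.functor.obj X).base) (η.hom.app X)
                  (ModelFrobenioid.unit g) =
              ModelFrobenioid.unit (Ψ.functor.map g) *
                pull (GlobalDivisorData.mk ((𝓕.baseMor ⋙ 𝓕.identify.functor).op ⋙ (GlobalDivisorData.arith F).Φ)
        ((𝓕.baseMor ⋙ 𝓕.identify.functor).op ⋙ (GlobalDivisorData.arith F).B)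
        (Functor.whiskerLeft (𝓕.baseMor ⋙ 𝓕.identify.functor).op (GlobalDivisorData.arith F).div) : GlobalDivisorData H).B (A := X.base) (B := (Ψ.functor.obj X).base) (η.hom.app X)
                  (ModelFrobenioid.unit f)) :
    CatIsomorphism.RigidOverBase 𝓕.fcircBase := by
  obtain ⟨Q, hQ⟩ := 𝓕.exists_fcirc_equivalence_fiberProduct_over
  obtain ⟨E, hE, -⟩ := ModelFrobenioid.exists_fiberProduct_equivalence (GlobalDivisorData.arith F).Φ
    (GlobalDivisorData.arith F).B (GlobalDivisorData.arith F).div (𝓕.baseMor ⋙ 𝓕.identify.functor)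
  have h1 : CatIsomorphism.RigidOverBase (ModelFrobenioid.baseFunctor
      ((𝓕.baseMor ⋙ 𝓕.identify.functor).op ⋙ (GlobalDivisorData.arith F).Φ)
      ((𝓕.baseMor ⋙ 𝓕.identify.functor).op ⋙ (GlobalDivisorData.arith F).B)
      (Functor.whiskerLeft (𝓕.baseMor ⋙ 𝓕.identify.functor).op (GlobalDivisorData.arith F).div)) :=
    whisker_rigidOverBase_of_ratioRigid F ((𝓕.baseMor ⋙ 𝓕.identify.functor) ⋙ galoisSubextOfFinite F) hZ hB
  have h2 := CatIsomorphism.rigidOverBase_of_equivalence_over E (eqToIso hE) h1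
  exact CatIsomorphism.rigidOverBase_of_equivalence_over Q (eqToIso hQ) h2

/-- **[IUTchI] Cor 5.3 (i) «resp. `⊚`», INJECTIVITY of `Aut(†ℱ^⊚) → Aut(†𝒟^⊚)` at the record carrier** (★ `Cor53TelescopeCensusKnit`
(k2) with `hker⊚` DISCHARGED modulo 𝔹-RATIO⊚). ([IUTchI] Cor 5.3 (i) p.144) [claim: Mochizuki2012, status: disputed] -/
theorem fcirc_descend_injective_of_ratioRigid (hZ : IsSlimGroup H)
    (hB : ∀ Ψ : (GlobalDivisorData.mk ((𝓕.baseMor ⋙ 𝓕.identify.functor).op ⋙ (GlobalDivisorData.arith F).Φ)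
        ((𝓕.baseMor ⋙ 𝓕.identify.functor).op ⋙ (GlobalDivisorData.arith F).B)
        (Functor.whiskerLeft (𝓕.baseMor ⋙ 𝓕.identify.functor).op (GlobalDivisorData.arith F).div) : GlobalDivisorData H).ModelGlobalFrobenioid ≌
        (GlobalDivisorData.mk ((𝓕.baseMor ⋙ 𝓕.identify.functor).op ⋙ (GlobalDivisorData.arith F).Φ)
        ((𝓕.baseMor ⋙ 𝓕.identify.functor).op ⋙ (GlobalDivisorData.arith F).B)
        (Functor.whiskerLeft (𝓕.baseMor ⋙ 𝓕.identify.functor).op (GlobalDivisorData.arith F).div) : GlobalDivisorData H).ModelGlobalFrobenioid,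
      Nonempty (Ψ.functor ⋙ (GlobalDivisorData.mk ((𝓕.baseMor ⋙ 𝓕.identify.functor).op ⋙ (GlobalDivisorData.arith F).Φ)
        ((𝓕.baseMor ⋙ 𝓕.identify.functor).op ⋙ (GlobalDivisorData.arith F).B)
        (Functor.whiskerLeft (𝓕.baseMor ⋙ 𝓕.identify.functor).op (GlobalDivisorData.arith F).div) : GlobalDivisorData H).modelBase ≅
        (GlobalDivisorData.mk ((𝓕.baseMor ⋙ 𝓕.identify.functor).op ⋙ (GlobalDivisorData.arith F).Φ)
        ((𝓕.baseMor ⋙ 𝓕.identify.functor).op ⋙ (GlobalDivisorData.arith F).B)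
        (Functor.whiskerLeft (𝓕.baseMor ⋙ 𝓕.identify.functor).op (GlobalDivisorData.arith F).div) : GlobalDivisorData H).modelBase) →
      ∃ η : Ψ.functor ⋙ (GlobalDivisorData.mk ((𝓕.baseMor ⋙ 𝓕.identify.functor).op ⋙ (GlobalDivisorData.arith F).Φ)
        ((𝓕.baseMor ⋙ 𝓕.identify.functor).op ⋙ (GlobalDivisorData.arith F).B)
        (Functor.whiskerLeft (𝓕.baseMor ⋙ 𝓕.identify.functor).op (GlobalDivisorData.arith F).div) : GlobalDivisorData H).modelBase ≅
        (GlobalDivisorData.mk ((𝓕.baseMor ⋙ 𝓕.identify.functor).op ⋙ (GlobalDivisorData.arith F).Φ)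
        ((𝓕.baseMor ⋙ 𝓕.identify.functor).op ⋙ (GlobalDivisorData.arith F).B)
        (Functor.whiskerLeft (𝓕.baseMor ⋙ 𝓕.identify.functor).op (GlobalDivisorData.arith F).div) : GlobalDivisorData H).modelBase,
        ∀ ⦃X Y : (GlobalDivisorData.mk ((𝓕.baseMor ⋙ 𝓕.identify.functor).op ⋙ (GlobalDivisorData.arith F).Φ)
        ((𝓕.baseMor ⋙ 𝓕.identify.functor).op ⋙ (GlobalDivisorData.arith F).B)
        (Functor.whiskerLeft (𝓕.baseMor ⋙ 𝓕.identify.functor).op (GlobalDivisorData.arith F).div) : GlobalDivisorData H).ModelGlobalFrobenioid⦄ (f g : X ⟶ Y),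
          ModelFrobenioid.degFr f = 1 → ModelFrobenioid.degFr g = 1 → ModelFrobenioid.baseMap f = ModelFrobenioid.baseMap g →
            ModelFrobenioid.unit (Ψ.functor.map f) *
                pull (GlobalDivisorData.mk ((𝓕.baseMor ⋙ 𝓕.identify.functor).op ⋙ (GlobalDivisorData.arith F).Φ)
        ((𝓕.baseMor ⋙ 𝓕.identify.functor).op ⋙ (GlobalDivisorData.arith F).B)
        (Functor.whiskerLeft (𝓕.baseMor ⋙ 𝓕.identify.functor).op (GlobalDivisorData.arith F).div) : GlobalDivisorData H).B (A := X.base) (B := (Ψ.functor.obj X).base) (η.hom.app X)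
                  (ModelFrobenioid.unit g) =
              ModelFrobenioid.unit (Ψ.functor.map g) *
                pull (GlobalDivisorData.mk ((𝓕.baseMor ⋙ 𝓕.identify.functor).op ⋙ (GlobalDivisorData.arith F).Φ)
        ((𝓕.baseMor ⋙ 𝓕.identify.functor).op ⋙ (GlobalDivisorData.arith F).B)
        (Functor.whiskerLeft (𝓕.baseMor ⋙ 𝓕.identify.functor).op (GlobalDivisorData.arith F).div) : GlobalDivisorData H).B (A := X.base) (B := (Ψ.functor.obj X).base) (η.hom.app X)
                  (ModelFrobenioid.unit f)) :
    Function.Injective (CatIsomorphism.descend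
      (GlobalFrobenioid.hasUnder_and_underUnique_fcircBase_arith_baseCat 𝓕 𝓕 hZ hZ).1
      (GlobalFrobenioid.hasUnder_and_underUnique_fcircBase_arith_baseCat 𝓕 𝓕 hZ hZ).2) :=
  fcirc_descend_injective_of_kernel_trivial 𝓕 hZ (fcirc_rigidOverBase_of_ratioRigid 𝓕 hZ hB)

/-- **[IUTchI] Cor 5.3 (i) «resp. `⊚`» AS PRINTED («bijective») at the record carrier**, from 𝔹-RATIO⊚ and the surjectivity half
`hlift⊚` (BY NAME). ([IUTchI] Cor 5.3 (i) p.144) [claim: Mochizuki2012, status: disputed] -/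
theorem fcirc_descendBijective_of_ratioRigid_of_lifts (hZ : IsSlimGroup H)
    (hB : ∀ Ψ : (GlobalDivisorData.mk ((𝓕.baseMor ⋙ 𝓕.identify.functor).op ⋙ (GlobalDivisorData.arith F).Φ)
        ((𝓕.baseMor ⋙ 𝓕.identify.functor).op ⋙ (GlobalDivisorData.arith F).B)
        (Functor.whiskerLeft (𝓕.baseMor ⋙ 𝓕.identify.functor).op (GlobalDivisorData.arith F).div) : GlobalDivisorData H).ModelGlobalFrobenioid ≌
        (GlobalDivisorData.mk ((𝓕.baseMor ⋙ 𝓕.identify.functor).op ⋙ (GlobalDivisorData.arith F).Φ)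
        ((𝓕.baseMor ⋙ 𝓕.identify.functor).op ⋙ (GlobalDivisorData.arith F).B)
        (Functor.whiskerLeft (𝓕.baseMor ⋙ 𝓕.identify.functor).op (GlobalDivisorData.arith F).div) : GlobalDivisorData H).ModelGlobalFrobenioid,
      Nonempty (Ψ.functor ⋙ (GlobalDivisorData.mk ((𝓕.baseMor ⋙ 𝓕.identify.functor).op ⋙ (GlobalDivisorData.arith F).Φ)
        ((𝓕.baseMor ⋙ 𝓕.identify.functor).op ⋙ (GlobalDivisorData.arith F).B)
        (Functor.whiskerLeft (𝓕.baseMor ⋙ 𝓕.identify.functor).op (GlobalDivisorData.arith F).div) : GlobalDivisorData H).modelBase ≅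
        (GlobalDivisorData.mk ((𝓕.baseMor ⋙ 𝓕.identify.functor).op ⋙ (GlobalDivisorData.arith F).Φ)
        ((𝓕.baseMor ⋙ 𝓕.identify.functor).op ⋙ (GlobalDivisorData.arith F).B)
        (Functor.whiskerLeft (𝓕.baseMor ⋙ 𝓕.identify.functor).op (GlobalDivisorData.arith F).div) : GlobalDivisorData H).modelBase) →
      ∃ η : Ψ.functor ⋙ (GlobalDivisorData.mk ((𝓕.baseMor ⋙ 𝓕.identify.functor).op ⋙ (GlobalDivisorData.arith F).Φ)
        ((𝓕.baseMor ⋙ 𝓕.identify.functor).op ⋙ (GlobalDivisorData.arith F).B)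
        (Functor.whiskerLeft (𝓕.baseMor ⋙ 𝓕.identify.functor).op (GlobalDivisorData.arith F).div) : GlobalDivisorData H).modelBase ≅
        (GlobalDivisorData.mk ((𝓕.baseMor ⋙ 𝓕.identify.functor).op ⋙ (GlobalDivisorData.arith F).Φ)
        ((𝓕.baseMor ⋙ 𝓕.identify.functor).op ⋙ (GlobalDivisorData.arith F).B)
        (Functor.whiskerLeft (𝓕.baseMor ⋙ 𝓕.identify.functor).op (GlobalDivisorData.arith F).div) : GlobalDivisorData H).modelBase,
        ∀ ⦃X Y : (GlobalDivisorData.mk ((𝓕.baseMor ⋙ 𝓕.identify.functor).op ⋙ (GlobalDivisorData.arith F).Φ)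
        ((𝓕.baseMor ⋙ 𝓕.identify.functor).op ⋙ (GlobalDivisorData.arith F).B)
        (Functor.whiskerLeft (𝓕.baseMor ⋙ 𝓕.identify.functor).op (GlobalDivisorData.arith F).div) : GlobalDivisorData H).ModelGlobalFrobenioid⦄ (f g : X ⟶ Y),
          ModelFrobenioid.degFr f = 1 → ModelFrobenioid.degFr g = 1 → ModelFrobenioid.baseMap f = ModelFrobenioid.baseMap g →
            ModelFrobenioid.unit (Ψ.functor.map f) *
                pull (GlobalDivisorData.mk ((𝓕.baseMor ⋙ 𝓕.identify.functor).op ⋙ (GlobalDivisorData.arith F).Φ)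
        ((𝓕.baseMor ⋙ 𝓕.identify.functor).op ⋙ (GlobalDivisorData.arith F).B)
        (Functor.whiskerLeft (𝓕.baseMor ⋙ 𝓕.identify.functor).op (GlobalDivisorData.arith F).div) : GlobalDivisorData H).B (A := X.base) (B := (Ψ.functor.obj X).base) (η.hom.app X)
                  (ModelFrobenioid.unit g) =
              ModelFrobenioid.unit (Ψ.functor.map g) *
                pull (GlobalDivisorData.mk ((𝓕.baseMor ⋙ 𝓕.identify.functor).op ⋙ (GlobalDivisorData.arith F).Φ)
        ((𝓕.baseMor ⋙ 𝓕.identify.functor).op ⋙ (GlobalDivisorData.arith F).B)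
        (Functor.whiskerLeft (𝓕.baseMor ⋙ 𝓕.identify.functor).op (GlobalDivisorData.arith F).div) : GlobalDivisorData H).B (A := X.base) (B := (Ψ.functor.obj X).base) (η.hom.app X)
                  (ModelFrobenioid.unit f))
    (hlift : ∀ Θ : BaseCat H ≌ BaseCat H, ∃ Ψ : 𝓕.Fcirc ≌ 𝓕.Fcirc,
      Nonempty (CatIsomorphism.LiesUnder 𝓕.fcircBase 𝓕.fcircBase Ψ Θ)) :
    CatIsomorphism.DescendBijective 𝓕.fcircBase 𝓕.fcircBase
      (GlobalFrobenioid.hasUnder_and_underUnique_fcircBase_arith_baseCat 𝓕 𝓕 hZ hZ).1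
      (GlobalFrobenioid.hasUnder_and_underUnique_fcircBase_arith_baseCat 𝓕 𝓕 hZ hZ).2 :=
  fcirc_descendBijective_of_kernel_trivial_of_lifts 𝓕 hZ (fcirc_rigidOverBase_of_ratioRigid 𝓕 hZ hB) hlift

end Fcirc

end Cor53

end Literature.IUT.HodgeTheaters

end
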